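import Mathlib
import HarnessLib
import Summits.Ventures.LatticeQCDFlow.Scoring.ReplicaError
import Summits.Ventures.LatticeQCDFlow.Scoring.ChainTimeAverage

/-!
# The naive (iid) error bar of an autocorrelated run: `E[s²_N/N] = Var(x̄_N) − σ²(2τ_N − 1)/(N − 1)`
# exactly; anti-conservative for positively autocorrelated samplers; honest after multiplication by
# the certified factor `(2/ε − 1)(N − 1)/(N + 1 − 2/ε)` under a Doeblin minorisation

HONEST FRAMING: exact (Metropolis-corrected) sampling algorithms for lattice gauge theory;
figures of merit are autocorrelation/cost numbers at stated couplings and volumes; no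
continuum-physics claim.

Venture `LatticeQCDFlow` (cell pub-lqcd), topic `Scoring`; FANOUT row 8 (`s0-cpn-nemc`, GEN-14).
NEW WORK of the cell, not a published result; no definition is introduced: row 11's
`Scoring.replicaSEsq X N = Σ_{n<N} (X_n − x̄_N)²/(N(N−1))` applied to the SAMPLES themselves IS the
naive squared error bar `s²_N/N` (sample variance over `N`) that treats an autocorrelated run as
`N` independent draws.  The batch-means companion is this row's `Scoring/BatchMeans.lean` (general
batch length; row 3's `Scoring/ChainBatchMeans.lean` its chain instance); this file is the `b = 1`
end, restated without batches and carried to the simulated chain through the bridge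
`Scoring/ChainTimeAverage.lean` (`chain_covariance`, `chain_marginal`, `chain_memLp`,
`variance_timeAverage_le_of_doeblin`) and the envelope of `Scoring/DoeblinAutocorrelation.lean`.
Printed counterpart NAMED ONLY: the "errors too small by `√(2τ_int)`" rule (Sokal 1989/1996
lectures; Madras–Sokal 1988), nothing cited as a fact.

## Content (`X_0, …, X_{N−1}` square integrable, equal means, `Cov(X_n, X_{n'}) = σ² ρ(|n − n'|)`,
## `ρ 0 = 1`, `N ≥ 2`; `τ_N = Scoring.tauIntN ρ N`; `Var(x̄_N) = 2 τ_N σ²/N`)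

* **`integral_naiveSEsq_eq`** — `E[s²_N/N] = Var(x̄_N) − σ² (2τ_N − 1)/(N − 1)`
  (`= σ² (N − 2τ_N)/(N(N − 1))`, `integral_naiveSEsq_eq'`);
* `half_le_tauIntN_of_nonneg` — `ρ ≥ 0 ⇒ τ_N ≥ 1/2`; **`integral_naiveSEsq_le_variance`** —
  `ρ ≥ 0`, `σ² ≥ 0` ⇒ `E[s²_N/N] ≤ Var(x̄_N)`;
* `abs_tauIntN_sub_half_le` — `|ρ(t)| ≤ M rᵗ` (`t ≥ 1`) ⇒ `|τ_N − 1/2| ≤ M r/(1 − r)`;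
  **`abs_integral_naiveSEsq_sub_variance_le`** — then `|E[s²_N/N] − Var(x̄_N)| ≤ 2σ² M r/((1−r)(N−1))`;
* **`variance_le_mul_integral_naiveSEsq`** — if `τ_N ≤ T` with `2T < N` (and `σ² ≥ 0`):
  `Var(x̄_N) ≤ (2T (N − 1)/(N − 2T)) · E[s²_N/N]` — the honesty factor.

The simulated chain (`κ` Markov, invariant `π`, the chain `P_π` from `π`; `f` bounded measurable,
`A_N` its time average, `s²_N/N = replicaSEsq (n ↦ f(X_n)) N`, `Var_π f = autocov κ π (f − πf) 0`):
* **`chain_naiveSEsq_le_variance_of_nonneg`** — all `autocov κ π (f − πf) t ≥ 0` (positive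
  kernels: the exact flow sampler, `Scoring/IndepMHKernelPositive.indepMH_autocov_nonneg`) ⇒
  `E[s²_N/N] ≤ Var[A_N]`: the naive error bar of a positively autocorrelated exact sampler is
  never honest, in expectation, for any observable and run length;
* **`chain_abs_naiveSEsq_sub_variance_le_of_doeblin`** — `κ(x, ·) ≥ ε π`, `ε > 0` ⇒
  `|E[s²_N/N] − Var[A_N]| ≤ 2 Var_π f (1 − ε)/(ε (N − 1))`;
* **`chain_variance_le_mul_naiveSEsq_of_doeblin`** — `κ(x, ·) ≥ ε π`, `ε > 0`, `2/ε − 1 < N` ⇒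
  `Var[A_N] ≤ ((2/ε − 1)(N − 1)/(N + 1 − 2/ε)) · E[s²_N/N]`: a Doeblin certificate converts the
  naive error bar into an honest one by an explicit factor (`→ 2/ε − 1`), with no autocorrelation
  estimate at all.

NOT CLAIMED: the scatter of `s²_N`; any `ε` for a concrete sampler; any number of ours.
-/

noncomputable section

namespace Summit.Ventures.LatticeQCDFlow.Scoring

open MeasureTheory ProbabilityTheory Filter Finset
open scoped ENNReal

/-! ### `τ_N` against `1/2` -/

section Tau

/-- `ρ ≥ 0 ⇒ τ_N ≥ 1/2`. -/
theorem half_le_tauIntN_of_nonneg {ρ : ℕ → ℝ} (hρ : ∀ t, 0 ≤ ρ t) (N : ℕ) :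
    1 / 2 ≤ tauIntN ρ N := by
  unfold tauIntN
  have h : 0 ≤ ∑ t ∈ range N, (1 - ((t : ℝ) + 1) / N) * ρ (t + 1) := by
    refine Finset.sum_nonneg fun t ht => mul_nonneg ?_ (hρ _)
    have hN : (0 : ℝ) < N := by
      have := mem_range.1 ht
      exact_mod_cast Nat.lt_of_le_of_lt (Nat.zero_le t) this
    have ht' : (t : ℝ) + 1 ≤ N := by exact_mod_cast Nat.succ_le_of_lt (mem_range.1 ht)
    rw [sub_nonneg, div_le_one hN]
    exact ht'
  linarith

/-- `|ρ(t)| ≤ M rᵗ` for `t ≥ 1` (`0 ≤ M`, `0 ≤ r < 1`) ⇒ `|τ_N − 1/2| ≤ M r/(1 − r)`. -/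
theorem abs_tauIntN_sub_half_le {ρ : ℕ → ℝ} {M r : ℝ} (hM : 0 ≤ M) (hr0 : 0 ≤ r) (hr1 : r < 1)
    (hρ : ∀ t, 1 ≤ t → |ρ t| ≤ M * r ^ t) (N : ℕ) :
    |tauIntN ρ N - 1 / 2| ≤ M * r / (1 - r) := by
  unfold tauIntN
  rw [add_sub_cancel_left]
  have hgeo := hasSum_geometric_of_lt_one hr0 hr1
  calc |∑ t ∈ range N, (1 - ((t : ℝ) + 1) / N) * ρ (t + 1)|
      ≤ ∑ t ∈ range N, |(1 - ((t : ℝ) + 1) / N) * ρ (t + 1)| := Finset.abs_sum_le_sum_abs _ _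
    _ ≤ ∑ t ∈ range N, M * r ^ (t + 1) := by
        refine Finset.sum_le_sum fun t ht => ?_
        have hN : (0 : ℝ) < N := by
          exact_mod_cast Nat.lt_of_le_of_lt (Nat.zero_le t) (mem_range.1 ht)
        have ht' : (t : ℝ) + 1 ≤ N := by exact_mod_cast Nat.succ_le_of_lt (mem_range.1 ht)
        have hw0 : 0 ≤ 1 - ((t : ℝ) + 1) / N := by rw [sub_nonneg, div_le_one hN]; exact ht'
        have hw1 : 1 - ((t : ℝ) + 1) / N ≤ 1 := by
          have : 0 ≤ ((t : ℝ) + 1) / N := by positivity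
          linarith
        rw [abs_mul, abs_of_nonneg hw0]
        calc (1 - ((t : ℝ) + 1) / N) * |ρ (t + 1)| ≤ 1 * (M * r ^ (t + 1)) :=
              mul_le_mul hw1 (hρ (t + 1) (Nat.succ_le_succ (Nat.zero_le _))) (abs_nonneg _)
                zero_le_one
          _ = M * r ^ (t + 1) := one_mul _
    _ = M * r * ∑ t ∈ range N, r ^ t := by
        rw [Finset.mul_sum]; exact Finset.sum_congr rfl fun t _ => by rw [pow_succ]; ring
    _ ≤ M * r * (1 - r)⁻¹ :=
        mul_le_mul_of_nonneg_left (sum_le_hasSum (range N) (fun t _ => pow_nonneg hr0 t) hgeo)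
          (mul_nonneg hM hr0)
    _ = M * r / (1 - r) := (div_eq_mul_inv _ _).symm

end Tau

/-! ### The naive error bar of a weakly stationary window -/

section Population

variable {Ω' : Type*} {mΩ' : MeasurableSpace Ω'} {μ : Measure Ω'} [IsProbabilityMeasure μ]
variable {X : ℕ → Ω' → ℝ} {N : ℕ}

/-- **THE NAIVE ERROR BAR IN EXPECTATION.**  For a square-integrable window `X_0, …, X_{N−1}`
(`N ≥ 2`) with equal means and `Cov(X_n, X_{n'}) = σ² ρ(|n − n'|)`, `ρ 0 = 1`:
`E[s²_N/N] = Var(x̄_N) − σ² (2τ_N − 1)/(N − 1)`, where `s²_N/N = Σ_n (X_n − x̄_N)²/(N(N−1))`. -/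
theorem integral_naiveSEsq_eq (hN : 2 ≤ N) (hX : ∀ n < N, MemLp (X n) 2 μ) (σ2 : ℝ) (ρ : ℕ → ℝ)
    (hρ : ρ 0 = 1) (hC : ∀ n < N, ∀ n' < N, cov[X n, X n'; μ] = σ2 * ρ (Nat.dist n n'))
    {m : ℝ} (hmean : ∀ n < N, μ[X n] = m) :
    μ[replicaSEsq X N]
      = Var[fun ω => (∑ n ∈ range N, X n ω) / N; μ] - σ2 * (2 * tauIntN ρ N - 1) / (N - 1) := by
  have hN0 : N ≠ 0 := by omega
  have hN' : (2 : ℝ) ≤ N := by exact_mod_cast hN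
  have hNne : (N : ℝ) ≠ 0 := by positivity
  have hN1 : (N : ℝ) - 1 ≠ 0 := by linarith
  have hmeanEq : replicaMean X N = fun ω => (∑ n ∈ range N, X n ω) / N := rfl
  have hVmean : Var[replicaMean X N; μ] = 2 * tauIntN ρ N * σ2 / N := by
    rw [hmeanEq]; exact variance_mean_range_of_cov_eq X σ2 ρ hρ hN0 hX hC
  have hVn : ∀ n ∈ range N, Var[X n; μ] = σ2 := fun n hn => by
    rw [← covariance_self (hX n (mem_range.1 hn)).aemeasurable, hC n (mem_range.1 hn) n
      (mem_range.1 hn), Nat.dist_self, hρ, mul_one]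
  unfold replicaSEsq
  rw [integral_div, integral_sum_sq_sub_replicaMean hN0 hX]
  have hspread : ∑ r ∈ range N, (μ[X r] - (∑ s ∈ range N, μ[X s]) / (N : ℝ)) ^ 2 = 0 := by
    refine Finset.sum_eq_zero fun r hr => ?_
    have hm' : ∀ s ∈ range N, μ[X s] = m := fun s hs => hmean s (mem_range.1 hs)
    rw [hm' r hr, Finset.sum_congr rfl hm', Finset.sum_const, Finset.card_range, nsmul_eq_mul,
      mul_div_cancel_left₀ m hNne, sub_self]
    ring
  rw [hspread, add_zero, Finset.sum_congr rfl hVn, Finset.sum_const, Finset.card_range,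
    nsmul_eq_mul, hVmean, ← hmeanEq, hVmean]
  field_simp
  ring

/-- The same as a closed form: `E[s²_N/N] = σ² (N − 2τ_N)/(N(N − 1))`. -/
theorem integral_naiveSEsq_eq' (hN : 2 ≤ N) (hX : ∀ n < N, MemLp (X n) 2 μ) (σ2 : ℝ)
    (ρ : ℕ → ℝ) (hρ : ρ 0 = 1)
    (hC : ∀ n < N, ∀ n' < N, cov[X n, X n'; μ] = σ2 * ρ (Nat.dist n n')) {m : ℝ}
    (hmean : ∀ n < N, μ[X n] = m) :
    μ[replicaSEsq X N] = σ2 * (N - 2 * tauIntN ρ N) / (N * (N - 1)) := by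
  have hN0 : N ≠ 0 := by omega
  have hN' : (2 : ℝ) ≤ N := by exact_mod_cast hN
  have hNne : (N : ℝ) ≠ 0 := by positivity
  have hN1 : (N : ℝ) - 1 ≠ 0 := by linarith
  rw [integral_naiveSEsq_eq hN hX σ2 ρ hρ hC hmean, variance_mean_range_of_cov_eq X σ2 ρ hρ hN0 hX hC]
  field_simp
  ring

/-- **Anti-conservative for positive autocorrelations**: `ρ ≥ 0`, `σ² ≥ 0` ⇒
`E[s²_N/N] ≤ Var(x̄_N)`. -/
theorem integral_naiveSEsq_le_variance (hN : 2 ≤ N) (hX : ∀ n < N, MemLp (X n) 2 μ) {σ2 : ℝ}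
    (hσ : 0 ≤ σ2) {ρ : ℕ → ℝ} (hρ : ρ 0 = 1) (hρ0 : ∀ t, 0 ≤ ρ t)
    (hC : ∀ n < N, ∀ n' < N, cov[X n, X n'; μ] = σ2 * ρ (Nat.dist n n')) {m : ℝ}
    (hmean : ∀ n < N, μ[X n] = m) :
    μ[replicaSEsq X N] ≤ Var[fun ω => (∑ n ∈ range N, X n ω) / N; μ] := by
  rw [integral_naiveSEsq_eq hN hX σ2 ρ hρ hC hmean]
  have hN' : (2 : ℝ) ≤ N := by exact_mod_cast hN
  have hτ := half_le_tauIntN_of_nonneg hρ0 N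
  have h : 0 ≤ σ2 * (2 * tauIntN ρ N - 1) / (N - 1) :=
    div_nonneg (mul_nonneg hσ (by linarith)) (by linarith)
  linarith

/-- **Certified two-sided bias under a geometric envelope**: `|ρ(t)| ≤ M rᵗ` (`t ≥ 1`, `0 ≤ M`,
`0 ≤ r < 1`, `σ² ≥ 0`) ⇒ `|E[s²_N/N] − Var(x̄_N)| ≤ 2σ² M r/((1 − r)(N − 1))`. -/
theorem abs_integral_naiveSEsq_sub_variance_le (hN : 2 ≤ N) (hX : ∀ n < N, MemLp (X n) 2 μ)
    {σ2 : ℝ} (hσ : 0 ≤ σ2) {ρ : ℕ → ℝ} (hρ : ρ 0 = 1) {M r : ℝ} (hM : 0 ≤ M) (hr0 : 0 ≤ r)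
    (hr1 : r < 1) (hρM : ∀ t, 1 ≤ t → |ρ t| ≤ M * r ^ t)
    (hC : ∀ n < N, ∀ n' < N, cov[X n, X n'; μ] = σ2 * ρ (Nat.dist n n')) {m : ℝ}
    (hmean : ∀ n < N, μ[X n] = m) :
    |μ[replicaSEsq X N] - Var[fun ω => (∑ n ∈ range N, X n ω) / N; μ]|
      ≤ 2 * σ2 * (M * r / (1 - r)) / (N - 1) := by
  rw [integral_naiveSEsq_eq hN hX σ2 ρ hρ hC hmean]
  have hN' : (2 : ℝ) ≤ N := by exact_mod_cast hN
  have hN1 : 0 < (N : ℝ) - 1 := by linarith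
  have hτ := abs_tauIntN_sub_half_le hM hr0 hr1 hρM N
  rw [show ∀ V c : ℝ, V - c - V = -c from fun V c => by ring, abs_neg, abs_div,
    abs_of_pos hN1, abs_mul, abs_of_nonneg hσ, div_le_div_iff_of_pos_right hN1]
  have h2 : |2 * tauIntN ρ N - 1| = 2 * |tauIntN ρ N - 1 / 2| := by
    rw [show 2 * tauIntN ρ N - 1 = 2 * (tauIntN ρ N - 1 / 2) by ring, abs_mul, abs_two]
  rw [h2]
  nlinarith [mul_le_mul_of_nonneg_left hτ hσ]

/-- **The honesty factor**: if `τ_N ≤ T` with `2T < N` and `σ² ≥ 0`, then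
`Var(x̄_N) ≤ (2T(N − 1)/(N − 2T)) · E[s²_N/N]`. -/
theorem variance_le_mul_integral_naiveSEsq (hN : 2 ≤ N) (hX : ∀ n < N, MemLp (X n) 2 μ)
    {σ2 : ℝ} (hσ : 0 ≤ σ2) {ρ : ℕ → ℝ} (hρ : ρ 0 = 1) {T : ℝ} (hτT : tauIntN ρ N ≤ T)
    (hTN : 2 * T < N)
    (hC : ∀ n < N, ∀ n' < N, cov[X n, X n'; μ] = σ2 * ρ (Nat.dist n n')) {m : ℝ}
    (hmean : ∀ n < N, μ[X n] = m) :
    Var[fun ω => (∑ n ∈ range N, X n ω) / N; μ]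
      ≤ 2 * T * (N - 1) / (N - 2 * T) * μ[replicaSEsq X N] := by
  have hN0 : N ≠ 0 := by omega
  have hN' : (2 : ℝ) ≤ N := by exact_mod_cast hN
  have hNpos : (0 : ℝ) < N := by linarith
  have hgap : 0 < (N : ℝ) - 2 * T := by linarith
  rw [integral_naiveSEsq_eq' hN hX σ2 ρ hρ hC hmean,
    variance_mean_range_of_cov_eq X σ2 ρ hρ hN0 hX hC]
  -- `2τσ²/N ≤ (2T(N−1)/(N−2T)) · σ²(N−2τ)/(N(N−1))`, i.e. `τ (N − 2T) ≤ T (N − 2τ)`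
  have hN1 : (N : ℝ) - 1 ≠ 0 := ne_of_gt (by linarith)
  have hrhs : 2 * T * ((N : ℝ) - 1) / (N - 2 * T) * (σ2 * (N - 2 * tauIntN ρ N) / (N * (N - 1)))
      = 2 * (T * (N - 2 * tauIntN ρ N) / (N - 2 * T)) * σ2 / N := by
    field_simp
  rw [hrhs]
  have hkey : tauIntN ρ N ≤ T * (N - 2 * tauIntN ρ N) / (N - 2 * T) := by
    rw [le_div_iff₀ hgap]; nlinarith
  have := mul_le_mul_of_nonneg_right (mul_le_mul_of_nonneg_left hkey (by norm_num : (0:ℝ) ≤ 2)) hσ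
  exact div_le_div_of_nonneg_right this hNpos.le

end Population

/-! ### The simulated chain -/

section Chain

variable {Ω : Type*} [MeasurableSpace Ω]
variable {κ : Kernel Ω Ω} [IsMarkovKernel κ] {π : Measure Ω} [IsProbabilityMeasure π] {ε : ℝ≥0∞}
variable {f : Ω → ℝ} {C : ℝ} {N : ℕ}

/-- `C(0) = 0 ⇒ C(t) = 0` (Cauchy–Schwarz), for the degenerate observables below. -/
theorem autocov_eq_zero_of_zero_lag {g : Ω → ℝ} (hg : Measurable g) {Cg : ℝ} (hCg : ∀ x, |g x| ≤ Cg)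
    (h0 : autocov κ π g 0 = 0) (t : ℕ) : autocov κ π g t = 0 := by
  obtain ⟨hm, hb⟩ := iterate_kop_bounded_measurable κ hg hCg t
  have hcs := sq_integral_mul_le π hg hm hCg hb
  rw [autocov_zero] at h0
  rw [h0, zero_mul] at hcs
  unfold autocov
  exact pow_eq_zero_iff (n := 2) (by norm_num) |>.1 (le_antisymm hcs (sq_nonneg _))

/-- **THE NAIVE ERROR BAR OF A POSITIVELY AUTOCORRELATED EXACT SAMPLER IS NEVER HONEST.**  For the
chain with kernel `κ` started in its invariant law `π`, `f` bounded measurable with every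
`autocov κ π (f − πf) t ≥ 0`, `N ≥ 2`: `E[s²_N/N] ≤ Var[A_N]`. -/
theorem chain_naiveSEsq_le_variance_of_nonneg (hπ : Kernel.Invariant κ π) (hf : Measurable f)
    (hC : ∀ x, |f x| ≤ C) (hN : 2 ≤ N) (hpos : ∀ t, 0 ≤ autocov κ π (fun y => f y - ∫ z, f z ∂π) t) :
    ∫ x, replicaSEsq (fun n (x : ℕ → Ω) => f (x n)) N x
        ∂(Kernel.trajMeasure (X := fun _ : ℕ => Ω) π
          (fun n : ℕ => κ.comap (fun h : (i : ↥(Finset.Iic n)) → Ω => h ⟨n, Finset.mem_Iic.2 le_rfl⟩)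
            (measurable_pi_apply _)))
      ≤ Var[fun x : ℕ → Ω => (∑ n ∈ range N, f (x n)) / N;
          Kernel.trajMeasure (X := fun _ : ℕ => Ω) π
            (fun n : ℕ => κ.comap (fun h : (i : ↥(Finset.Iic n)) → Ω => h ⟨n, Finset.mem_Iic.2 le_rfl⟩)
              (measurable_pi_apply _))] := by
  set m := ∫ z, f z ∂π with hm
  have hgm : Measurable fun y => f y - m := hf.sub measurable_const
  have hgb : ∀ y, |f y - m| ≤ C + |m| := fun y => (abs_sub _ _).trans (add_le_add (hC y) le_rfl)
  by_cases hvar : autocov κ π (fun y => f y - m) 0 = 0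
  · have hall : ∀ t, autocov κ π (fun y => f y - m) t = 0 :=
      autocov_eq_zero_of_zero_lag hgm hgb hvar
    exact integral_naiveSEsq_le_variance (X := fun n (x : ℕ → Ω) => f (x n)) hN
      (fun n _ => chain_memLp π hf hC n) (σ2 := 0) le_rfl
      (ρ := fun t => if t = 0 then (1 : ℝ) else 0) (by simp) (fun t => by split_ifs <;> norm_num)
      (fun n _ n' _ => by rw [chain_covariance hπ hf hC n n', hall, zero_mul])
      (m := m) (fun n _ => chain_marginal hπ n hf hC)
  · have hσ : 0 ≤ autocov κ π (fun y => f y - m) 0 := hpos 0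
    exact integral_naiveSEsq_le_variance (X := fun n (x : ℕ → Ω) => f (x n)) hN
      (fun n _ => chain_memLp π hf hC n) hσ
      (ρ := fun t => autocov κ π (fun y => f y - m) t / autocov κ π (fun y => f y - m) 0)
      (div_self hvar) (fun t => div_nonneg (hpos t) hσ)
      (fun n _ n' _ => by rw [chain_covariance hπ hf hC n n', mul_div_cancel₀ _ hvar])
      (m := m) (fun n _ => chain_marginal hπ n hf hC)

/-- **CERTIFIED BIAS OF THE NAIVE ERROR BAR UNDER DOEBLIN.**  Same chain with `κ(x, ·) ≥ ε π`
(`ε > 0`), every bounded measurable `f`, `N ≥ 2`: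
`|E[s²_N/N] − Var[A_N]| ≤ 2 Var_π f (1 − ε)/(ε (N − 1))`. -/
theorem chain_abs_naiveSEsq_sub_variance_le_of_doeblin (hπ : Kernel.Invariant κ π)
    (hmin : ∀ x {B : Set Ω}, MeasurableSet B → ε * π B ≤ κ x B) (hε0 : 0 < ε)
    (hf : Measurable f) (hC : ∀ x, |f x| ≤ C) (hN : 2 ≤ N) :
    |∫ x, replicaSEsq (fun n (x : ℕ → Ω) => f (x n)) N x
        ∂(Kernel.trajMeasure (X := fun _ : ℕ => Ω) π
          (fun n : ℕ => κ.comap (fun h : (i : ↥(Finset.Iic n)) → Ω => h ⟨n, Finset.mem_Iic.2 le_rfl⟩)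
            (measurable_pi_apply _)))
      - Var[fun x : ℕ → Ω => (∑ n ∈ range N, f (x n)) / N;
          Kernel.trajMeasure (X := fun _ : ℕ => Ω) π
            (fun n : ℕ => κ.comap (fun h : (i : ↥(Finset.Iic n)) → Ω => h ⟨n, Finset.mem_Iic.2 le_rfl⟩)
              (measurable_pi_apply _))]|
      ≤ 2 * autocov κ π (fun y => f y - ∫ z, f z ∂π) 0 * (1 - ε.toReal) / (ε.toReal * (N - 1)) := by
  set m := ∫ z, f z ∂π with hm
  have hgm : Measurable fun y => f y - m := hf.sub measurable_const
  have hgb : ∀ y, |f y - m| ≤ C + |m| := fun y => (abs_sub _ _).trans (add_le_add (hC y) le_rfl)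
  have hg0 : ∫ y, (f y - m) ∂π = 0 := by
    rw [integral_sub (integrable_of_bounded π hf hC) (integrable_const _), integral_const,
      probReal_univ, one_smul, hm, sub_self]
  have hε1 := eps_le_one_of_doeblin hmin
  have hεr0 : 0 < ε.toReal := ENNReal.toReal_pos hε0.ne' (ne_top_of_le_ne_top ENNReal.one_ne_top hε1)
  have hr0 : 0 ≤ 1 - ε.toReal := one_sub_toReal_nonneg_of_doeblin hmin
  have hr1 : 1 - ε.toReal < 1 := by linarith
  have hN' : (2 : ℝ) ≤ N := by exact_mod_cast hN
  have hσ : 0 ≤ autocov κ π (fun y => f y - m) 0 := by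
    rw [autocov_zero]; exact integral_nonneg fun _ => sq_nonneg _
  by_cases hvar : autocov κ π (fun y => f y - m) 0 = 0
  · have hall : ∀ t, autocov κ π (fun y => f y - m) t = 0 :=
      autocov_eq_zero_of_zero_lag hgm hgb hvar
    have hid := integral_naiveSEsq_eq (X := fun n (x : ℕ → Ω) => f (x n)) hN
      (fun n _ => chain_memLp π hf hC n) (0 : ℝ) (fun t => if t = 0 then (1 : ℝ) else 0) (by simp)
      (fun n _ n' _ => by rw [chain_covariance hπ hf hC n n', hall, zero_mul])
      (m := m) (fun n _ => chain_marginal hπ n hf hC)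
    rw [hid, hvar]
    simp
  · have hid := abs_integral_naiveSEsq_sub_variance_le (X := fun n (x : ℕ → Ω) => f (x n)) hN
      (fun n _ => chain_memLp π hf hC n) hσ
      (ρ := fun t => autocov κ π (fun y => f y - m) t / autocov κ π (fun y => f y - m) 0)
      (div_self hvar) zero_le_one hr0 hr1
      (fun t _ => by rw [one_mul]; exact abs_acf_le_of_doeblin hπ hmin hgm hgb hg0 t)
      (fun n _ n' _ => by rw [chain_covariance hπ hf hC n n', mul_div_cancel₀ _ hvar])
      (m := m) (fun n _ => chain_marginal hπ n hf hC)
    refine hid.trans (le_of_eq ?_)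
    rw [one_mul, sub_sub_cancel]
    field_simp

/-- **THE HONESTY FACTOR UNDER DOEBLIN.**  Same chain with `κ(x, ·) ≥ ε π` (`ε > 0`), every bounded
measurable `f`, `N ≥ 2` with `2/ε − 1 < N`:
`Var[A_N] ≤ ((2/ε − 1)(N − 1)/(N − (2/ε − 1))) · E[s²_N/N]`. -/
theorem chain_variance_le_mul_naiveSEsq_of_doeblin (hπ : Kernel.Invariant κ π)
    (hmin : ∀ x {B : Set Ω}, MeasurableSet B → ε * π B ≤ κ x B) (hε0 : 0 < ε)
    (hf : Measurable f) (hC : ∀ x, |f x| ≤ C) (hN : 2 ≤ N) (hNε : 2 / ε.toReal - 1 < N) :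
    Var[fun x : ℕ → Ω => (∑ n ∈ range N, f (x n)) / N;
        Kernel.trajMeasure (X := fun _ : ℕ => Ω) π
          (fun n : ℕ => κ.comap (fun h : (i : ↥(Finset.Iic n)) → Ω => h ⟨n, Finset.mem_Iic.2 le_rfl⟩)
            (measurable_pi_apply _))]
      ≤ (2 / ε.toReal - 1) * (N - 1) / (N - (2 / ε.toReal - 1))
        * ∫ x, replicaSEsq (fun n (x : ℕ → Ω) => f (x n)) N x
          ∂(Kernel.trajMeasure (X := fun _ : ℕ => Ω) π
            (fun n : ℕ => κ.comap (fun h : (i : ↥(Finset.Iic n)) → Ω => h ⟨n, Finset.mem_Iic.2 le_rfl⟩)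
              (measurable_pi_apply _))) := by
  set m := ∫ z, f z ∂π with hm
  have hgm : Measurable fun y => f y - m := hf.sub measurable_const
  have hgb : ∀ y, |f y - m| ≤ C + |m| := fun y => (abs_sub _ _).trans (add_le_add (hC y) le_rfl)
  have hg0 : ∫ y, (f y - m) ∂π = 0 := by
    rw [integral_sub (integrable_of_bounded π hf hC) (integrable_const _), integral_const,
      probReal_univ, one_smul, hm, sub_self]
  have hσ : 0 ≤ autocov κ π (fun y => f y - m) 0 := by
    rw [autocov_zero]; exact integral_nonneg fun _ => sq_nonneg _
  have hT : (2 : ℝ) * (1 / ε.toReal - 1 / 2) = 2 / ε.toReal - 1 := by ring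
  by_cases hvar : autocov κ π (fun y => f y - m) 0 = 0
  · have hall : ∀ t, autocov κ π (fun y => f y - m) t = 0 :=
      autocov_eq_zero_of_zero_lag hgm hgb hvar
    -- `ρ = 1_{t=0}` has `τ_N = 1/2 ≤ 1/ε − 1/2`
    have hτ : tauIntN (fun t => if t = 0 then (1 : ℝ) else 0) N ≤ 1 / ε.toReal - 1 / 2 := by
      have h1 : tauIntN (fun t => if t = 0 then (1 : ℝ) else 0) N = 1 / 2 := by
        unfold tauIntN; simp
      rw [h1]
      have hε1 := eps_le_one_of_doeblin hmin
      have hεr1 : ε.toReal ≤ 1 := by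
        have := ENNReal.toReal_mono ENNReal.one_ne_top hε1; simpa using this
      have hεr0 : 0 < ε.toReal :=
        ENNReal.toReal_pos hε0.ne' (ne_top_of_le_ne_top ENNReal.one_ne_top hε1)
      have : 1 ≤ 1 / ε.toReal := by rw [le_div_iff₀ hεr0]; linarith
      linarith
    have h := variance_le_mul_integral_naiveSEsq (X := fun n (x : ℕ → Ω) => f (x n)) hN
      (fun n _ => chain_memLp π hf hC n) (σ2 := 0) le_rfl
      (ρ := fun t => if t = 0 then (1 : ℝ) else 0) (by simp) hτ (by rw [hT]; exact hNε)
      (fun n _ n' _ => by rw [chain_covariance hπ hf hC n n', hall, zero_mul])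
      (m := m) (fun n _ => chain_marginal hπ n hf hC)
    rw [hT] at h
    exact h
  · have hτ := tauInt_le_of_doeblin hπ hmin hε0 hgm hgb hg0
    -- finite-`N` version of the ceiling: `τ_N ≤ 1/ε − 1/2` via the envelope
    have hτN : tauIntN (fun t => autocov κ π (fun y => f y - m) t / autocov κ π (fun y => f y - m) 0) N
        ≤ 1 / ε.toReal - 1 / 2 := by
      have hε1 := eps_le_one_of_doeblin hmin
      have hεr0 : 0 < ε.toReal :=
        ENNReal.toReal_pos hε0.ne' (ne_top_of_le_ne_top ENNReal.one_ne_top hε1)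
      have hr0 : 0 ≤ 1 - ε.toReal := one_sub_toReal_nonneg_of_doeblin hmin
      have hr1 : 1 - ε.toReal < 1 := by linarith
      have h := abs_tauIntN_sub_half_le (M := 1) zero_le_one hr0 hr1
        (ρ := fun t => autocov κ π (fun y => f y - m) t / autocov κ π (fun y => f y - m) 0)
        (fun t _ => by rw [one_mul]; exact abs_acf_le_of_doeblin hπ hmin hgm hgb hg0 t) N
      have h' := (abs_le.1 h).2
      rw [one_mul, sub_sub_cancel] at h'
      have he : (1 - ε.toReal) / ε.toReal = 1 / ε.toReal - 1 := by field_simp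
      linarith
    have h := variance_le_mul_integral_naiveSEsq (X := fun n (x : ℕ → Ω) => f (x n)) hN
      (fun n _ => chain_memLp π hf hC n) hσ
      (ρ := fun t => autocov κ π (fun y => f y - m) t / autocov κ π (fun y => f y - m) 0)
      (div_self hvar) hτN (by rw [hT]; exact hNε)
      (fun n _ n' _ => by rw [chain_covariance hπ hf hC n n', mul_div_cancel₀ _ hvar])
      (m := m) (fun n _ => chain_marginal hπ n hf hC)
    rw [hT] at h
    exact h

end Chain

end Summit.Ventures.LatticeQCDFlow.Scoring

end
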